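import Summits.RiemannHypothesis.RiemannHypothesis.Theorems.TiltedLandingLaw421Seam04

/-! # TiltedLandingLaw421 — descent seam, part 05
Token-identical port of the descent framework of `Cruxes/TiltedLandingLaw421/Lines/law421birthS.lean`
(seam canon ce03e18b) into flat Theorems modules, so that crux line files can import it instead of inlining it.
No new mathematics; no `sorry`; no route (Theses) imports — the tree statement is mirrored as `RhW07.Seam.Law421Statement`. -/

open Complex Metric Set
open scoped ComplexConjugate
namespace RhIdea6.G18.W07C8.Law421BirthS
open Set Complex
open Summit.RiemannHypothesis.RiemannHypothesis.Theorems.Splittings.JensenWindow (LocalA)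
open Summit.RiemannHypothesis.RiemannHypothesis.Theorems.Splittings.EarlyAppointmentsLocalFourierPolya
open RhIdea6.G17.W07C7 RhIdea6.G17.W07C7.Rev6

/-- `law421_ofS'` — seam of the TiltedLandingLaw421 descent framework, part 05 (token-identical port of `Cruxes/TiltedLandingLaw421/Lines/law421birthS.lean`; no new mathematics). -/
theorem law421_ofS' (hDesc : DescentSigS') (hHer : AnalyticHereditySig) : SeamTiltedLandingLaw421 := by
  intro η f x₀ s hmax R Hs B hE
  have hE' := hE
  obtain ⟨hdiff, hreal, hgrowth, hs, hsh, hhR, h3R, hHs, hstrip, hHsR, hpair, hcol, hhalf, hη0, hη1, hrem⟩ := hE'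
  have hC0 : InClass f Hs := ⟨hdiff, hreal, hgrowth, hstrip⟩
  obtain ⟨j, α, β, H, hj, hα, hβ, hnz, hW⟩ := hDesc η f x₀ s hmax R Hs B hE
  obtain ⟨hlt, hH, hgα, hgβ, hdα, hdβ, htop, hleft, hright, hA, hz⟩ := hW
  have hCj : InClass (iteratedDeriv j f) Hs := hHer f Hs j hHs hC0 hnz
  obtain ⟨x, hxI, hdx, hgx, hsign⟩ :=
    exists_nonLaguerre_critical_of_boundary_sign hCj.1 hCj.2.1 hlt hH hgα hgβ hdα hdβ htop hleft hright hA hz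
  have h1 : iteratedDeriv (j + 1) f = deriv (iteratedDeriv j f) := iteratedDeriv_succ
  have h2 : iteratedDeriv (j + 2) f = deriv (deriv (iteratedDeriv j f)) := by
    show iteratedDeriv (j + 1 + 1) f = _
    rw [iteratedDeriv_succ, iteratedDeriv_succ]
  have hgim : (iteratedDeriv j f (x : ℂ)).im = 0 := hCj.2.1 x
  have hev : NLEventOf f j x := by
    refine ⟨?_, ?_, ?_⟩
    · rw [h1, hdx]; simp
    · intro hre
      exact hgx (Complex.ext (by simpa using hre) (by simpa using hgim))
    · rw [h2]
      have hmul : (iteratedDeriv j f (x : ℂ) * deriv (deriv (iteratedDeriv j f)) (x : ℂ)).re =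
          (iteratedDeriv j f (x : ℂ)).re * (deriv (deriv (iteratedDeriv j f)) (x : ℂ)).re := by
        rw [Complex.mul_re, hgim, zero_mul, sub_zero]
      rw [← hmul]; exact hsign
  refine ⟨j, ?_, x, ?_, hev⟩
  · have : (1 : ℝ) * (Hs / s) ^ 2 = (Hs / s) ^ 2 := one_mul _
    linarith
  · rw [abs_sub_lt_iff]
    constructor <;> linarith [hxI.1, hxI.2]

/-- `law421T_ofS'` — seam of the TiltedLandingLaw421 descent framework, part 05 (token-identical port of `Cruxes/TiltedLandingLaw421/Lines/law421birthS.lean`; no new mathematics). -/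
theorem law421T_ofS' (hDesc : DescentSigS') (hHer : AnalyticHereditySig) :
    RhW07.Seam.Law421Statement :=
  law421_tree_iff.mpr (law421_ofS' hDesc hHer)

example (hDesc : DescentSigS) (hHer : AnalyticHereditySig) : SeamTiltedLandingLaw421 :=
  law421_ofS' (descentSigS'_of_descentSigS hDesc) hHer

end RhIdea6.G18.W07C8.Law421BirthS
namespace RhIdea6.G19.W07C11.Seam
open Set Complex
open Summit.RiemannHypothesis.RiemannHypothesis.Theorems.Splittings.JensenWindow (LocalA)
open RhIdea6.G17.W07C7 RhIdea6.G17.W07C7.Rev6 RhIdea6.G18.W07C8.Law421BirthS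
/-- `StatePred` — seam of the TiltedLandingLaw421 descent framework, part 05 (token-identical port of `Cruxes/TiltedLandingLaw421/Lines/law421birthS.lean`; no new mathematics). -/
abbrev StatePred : Type := ℝ → (ℂ → ℂ) → ℝ → ℝ → ℝ → ℝ → ℝ → ℕ → ℕ → ℂ → Prop

/-- `Potential` — seam of the TiltedLandingLaw421 descent framework, part 05 (token-identical port of `Cruxes/TiltedLandingLaw421/Lines/law421birthS.lean`; no new mathematics). -/
abbrev Potential : Type := ℝ → (ℂ → ℂ) → ℝ → ℝ → ℝ → ℝ → ℝ → ℕ → ℕ → ℂ → ℝ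

/-- `DescentSigC` — seam of the TiltedLandingLaw421 descent framework, part 05 (token-identical port of `Cruxes/TiltedLandingLaw421/Lines/law421birthS.lean`; no new mathematics). -/
def DescentSigC (c : ℝ) : Prop := ∀ (η : ℝ) (f : ℂ → ℂ) (x₀ s hmax R Hs : ℝ) (B : ℕ),
  EngineHyps5 2 η f x₀ s hmax R Hs B →
    ∃ (j : ℕ) (α β H : ℝ), (j : ℝ) ≤ 4 * hmax / s + (Hs / s) ^ 2 + B + c ∧
      x₀ - (j + 3) * R / 2 ≤ α ∧ β ≤ x₀ + (j + 3) * R / 2 ∧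
      iteratedDeriv j f ≠ 0 ∧ SignWindow (iteratedDeriv j f) α β H

/-- `descentSigS_of_descentSigC` — seam of the TiltedLandingLaw421 descent framework, part 05 (token-identical port of `Cruxes/TiltedLandingLaw421/Lines/law421birthS.lean`; no new mathematics). -/
theorem descentSigS_of_descentSigC (h : DescentSigC 0) : DescentSigS := by
  intro η f x₀ s hmax R Hs B hE
  obtain ⟨j, α, β, H, hj, hα, hβ, hnz, hW⟩ := h η f x₀ s hmax R Hs B hE
  exact ⟨j, α, β, H, by linarith, hα, hβ, hnz, hW⟩

/-- `descentSigS'_of_descentSigC` — seam of the TiltedLandingLaw421 descent framework, part 05 (token-identical port of `Cruxes/TiltedLandingLaw421/Lines/law421birthS.lean`; no new mathematics). -/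
theorem descentSigS'_of_descentSigC (h : DescentSigC 1) : DescentSigS' := by
  intro η f x₀ s hmax R Hs B hE
  obtain ⟨j, α, β, H, hj, hα, hβ, hnz, hW⟩ := h η f x₀ s hmax R Hs B hE
  exact ⟨j, α, β, H, by linarith, hα, hβ, hnz, hW⟩

/-- `InitSig` — seam of the TiltedLandingLaw421 descent framework, part 05 (token-identical port of `Cruxes/TiltedLandingLaw421/Lines/law421birthS.lean`; no new mathematics). -/
def InitSig (c : ℝ) (St : StatePred) (Φ : Potential) : Prop :=
  ∀ (η : ℝ) (f : ℂ → ℂ) (x₀ s hmax R Hs : ℝ) (B : ℕ), EngineHyps5 2 η f x₀ s hmax R Hs B →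
    ∃ u : ℂ, St η f x₀ s hmax R Hs B 0 u ∧ Φ η f x₀ s hmax R Hs B 0 u ≤ 4 * hmax / s + (Hs / s) ^ 2 + B + c

/-- `StepSig` — seam of the TiltedLandingLaw421 descent framework, part 05 (token-identical port of `Cruxes/TiltedLandingLaw421/Lines/law421birthS.lean`; no new mathematics). -/
def StepSig (St : StatePred) (Φ : Potential) (Ready : StatePred) : Prop :=
  ∀ (η : ℝ) (f : ℂ → ℂ) (x₀ s hmax R Hs : ℝ) (B : ℕ), EngineHyps5 2 η f x₀ s hmax R Hs B →
    ∀ (j : ℕ) (u : ℂ), St η f x₀ s hmax R Hs B j u → ¬ Ready η f x₀ s hmax R Hs B j u →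
      ∃ u' : ℂ, St η f x₀ s hmax R Hs B (j + 1) u' ∧ 0 ≤ Φ η f x₀ s hmax R Hs B (j + 1) u' ∧
        Φ η f x₀ s hmax R Hs B (j + 1) u' + 1 ≤ Φ η f x₀ s hmax R Hs B j u

/-- `LandSig` — seam of the TiltedLandingLaw421 descent framework, part 05 (token-identical port of `Cruxes/TiltedLandingLaw421/Lines/law421birthS.lean`; no new mathematics). -/
def LandSig (St Ready : StatePred) : Prop :=
  ∀ (η : ℝ) (f : ℂ → ℂ) (x₀ s hmax R Hs : ℝ) (B : ℕ), EngineHyps5 2 η f x₀ s hmax R Hs B →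
    ∀ (j : ℕ) (u : ℂ), St η f x₀ s hmax R Hs B j u → Ready η f x₀ s hmax R Hs B j u →
      iteratedDeriv j f ≠ 0 ∧ ∃ (α β H : ℝ), x₀ - (j + 3) * R / 2 ≤ α ∧ β ≤ x₀ + (j + 3) * R / 2 ∧
        SignWindow (iteratedDeriv j f) α β H

/-- `descent_core` — seam of the TiltedLandingLaw421 descent framework, part 05 (token-identical port of `Cruxes/TiltedLandingLaw421/Lines/law421birthS.lean`; no new mathematics). -/
theorem descent_core {St Ready : ℕ → ℂ → Prop} {Φ : ℕ → ℂ → ℝ} {A : ℝ}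
    (hS : ∀ (j : ℕ) (u : ℂ), St j u → ¬ Ready j u → ∃ u' : ℂ, St (j + 1) u' ∧ 0 ≤ Φ (j + 1) u' ∧ Φ (j + 1) u' + 1 ≤ Φ j u)
    {u₀ : ℂ} (h0 : St 0 u₀) (hΦ0 : Φ 0 u₀ ≤ A) (hA : 0 ≤ A) :
    ∃ (j : ℕ) (u : ℂ), (j : ℝ) ≤ A ∧ St j u ∧ Ready j u := by
  have key : ∀ (n : ℕ) (j : ℕ) (u : ℂ), St j u → (j : ℝ) + Φ j u ≤ A → (j : ℝ) ≤ A → Φ j u < n →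
      ∃ (j' : ℕ) (u' : ℂ), (j' : ℝ) ≤ A ∧ St j' u' ∧ Ready j' u' := by
    intro n
    induction n with
    | zero =>
      intro j u hSt _ hj hΦ
      by_cases hR : Ready j u
      · exact ⟨j, u, hj, hSt, hR⟩
      · obtain ⟨u', -, h0', h1'⟩ := hS j u hSt hR
        exfalso
        push_cast at hΦ
        linarith
    | succ n ih =>
      intro j u hSt hjΦ hj hΦ
      by_cases hR : Ready j u
      · exact ⟨j, u, hj, hSt, hR⟩
      · obtain ⟨u', hSt', h0', h1'⟩ := hS j u hSt hR
        refine ih (j + 1) u' hSt' ?_ ?_ ?_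
        · push_cast; linarith
        · push_cast; linarith
        · push_cast at hΦ ⊢; linarith
  obtain ⟨n, hn⟩ := exists_nat_gt (Φ 0 u₀)
  exact key n 0 u₀ h0 (by push_cast; linarith) (by push_cast; linarith) hn

/-- `allowance_nonneg` — seam of the TiltedLandingLaw421 descent framework, part 05 (token-identical port of `Cruxes/TiltedLandingLaw421/Lines/law421birthS.lean`; no new mathematics). -/
theorem allowance_nonneg {s hmax Hs c : ℝ} {B : ℕ} (hs : 0 < s) (hsh : 2 * s ≤ hmax) (hc : 0 ≤ c) :
    0 ≤ 4 * hmax / s + (Hs / s) ^ 2 + B + c := by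
  have h1 : 0 ≤ 4 * hmax / s := by
    have : 0 ≤ hmax := by linarith
    positivity
  have h2 : 0 ≤ (Hs / s) ^ 2 := sq_nonneg _
  have h3 : (0 : ℝ) ≤ B := Nat.cast_nonneg _
  linarith

/-- `descentSigC_of_seam` — seam of the TiltedLandingLaw421 descent framework, part 05 (token-identical port of `Cruxes/TiltedLandingLaw421/Lines/law421birthS.lean`; no new mathematics). -/
theorem descentSigC_of_seam (c : ℝ) (hc : 0 ≤ c) (St : StatePred) (Φ : Potential) (Ready : StatePred)
    (hI : InitSig c St Φ) (hS : StepSig St Φ Ready) (hL : LandSig St Ready) : DescentSigC c := by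
  intro η f x₀ s hmax R Hs B hE
  have hE' := hE
  obtain ⟨-, -, -, hs, hsh, -, -, -, -, -, -, -, -, -, -, -⟩ := hE'
  obtain ⟨u₀, hSt0, hΦ0⟩ := hI η f x₀ s hmax R Hs B hE
  obtain ⟨j, u, hj, hSt, hR⟩ :=
    descent_core (hS η f x₀ s hmax R Hs B hE) hSt0 hΦ0 (allowance_nonneg hs hsh hc)
  obtain ⟨hnz, α, β, H, hα, hβ, hW⟩ := hL η f x₀ s hmax R Hs B hE j u hSt hR
  exact ⟨j, α, β, H, hj, hα, hβ, hnz, hW⟩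

/-- `descentSigS_of_seam` — seam of the TiltedLandingLaw421 descent framework, part 05 (token-identical port of `Cruxes/TiltedLandingLaw421/Lines/law421birthS.lean`; no new mathematics). -/
theorem descentSigS_of_seam (St : StatePred) (Φ : Potential) (Ready : StatePred)
    (hI : InitSig 0 St Φ) (hS : StepSig St Φ Ready) (hL : LandSig St Ready) : DescentSigS :=
  descentSigS_of_descentSigC (descentSigC_of_seam 0 le_rfl St Φ Ready hI hS hL)

/-- `descentSigS'_of_seam` — seam of the TiltedLandingLaw421 descent framework, part 05 (token-identical port of `Cruxes/TiltedLandingLaw421/Lines/law421birthS.lean`; no new mathematics). -/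
theorem descentSigS'_of_seam (St : StatePred) (Φ : Potential) (Ready : StatePred)
    (hI : InitSig 1 St Φ) (hS : StepSig St Φ Ready) (hL : LandSig St Ready) : DescentSigS' :=
  descentSigS'_of_descentSigC (descentSigC_of_seam 1 zero_le_one St Φ Ready hI hS hL)

/-- `law421T_of_seam` — seam of the TiltedLandingLaw421 descent framework, part 05 (token-identical port of `Cruxes/TiltedLandingLaw421/Lines/law421birthS.lean`; no new mathematics). -/
private theorem law421T_of_seam (St : StatePred) (Φ : Potential) (Ready : StatePred)
    (hI : InitSig 0 St Φ) (hS : StepSig St Φ Ready) (hL : LandSig St Ready) (hHer : AnalyticHereditySig) :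
    RhW07.Seam.Law421Statement :=
  law421T_ofS (descentSigS_of_seam St Φ Ready hI hS hL) hHer

/-- `law421T_of_seam'` — seam of the TiltedLandingLaw421 descent framework, part 05 (token-identical port of `Cruxes/TiltedLandingLaw421/Lines/law421birthS.lean`; no new mathematics). -/
private theorem law421T_of_seam' (St : StatePred) (Φ : Potential) (Ready : StatePred)
    (hI : InitSig 1 St Φ) (hS : StepSig St Φ Ready) (hL : LandSig St Ready) (hHer : AnalyticHereditySig) :
    RhW07.Seam.Law421Statement :=
  law421T_ofS' (descentSigS'_of_seam St Φ Ready hI hS hL) hHer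

/-- `Init0Sig` — seam of the TiltedLandingLaw421 descent framework, part 05 (token-identical port of `Cruxes/TiltedLandingLaw421/Lines/law421birthS.lean`; no new mathematics). -/
def Init0Sig (St : StatePred) : Prop :=
  ∀ (η : ℝ) (f : ℂ → ℂ) (x₀ s hmax R Hs : ℝ) (B : ℕ), EngineHyps5 2 η f x₀ s hmax R Hs B →
    ∃ u : ℂ, St η f x₀ s hmax R Hs B 0 u ∧ |u.im| ≤ hmax

/-- `SurplusSig` — seam of the TiltedLandingLaw421 descent framework, part 05 (token-identical port of `Cruxes/TiltedLandingLaw421/Lines/law421birthS.lean`; no new mathematics). -/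
def SurplusSig (cE : ℝ) (St Ready Frozen : StatePred) : Prop :=
  ∀ (η : ℝ) (f : ℂ → ℂ) (x₀ s hmax R Hs : ℝ) (B : ℕ), EngineHyps5 2 η f x₀ s hmax R Hs B →
    ∃ E : Finset ℕ, (E.card : ℝ) ≤ (Hs / s) ^ 2 + B + cE ∧
      ∀ (j : ℕ) (u : ℂ), j ∉ E → St η f x₀ s hmax R Hs B j u →
        Ready η f x₀ s hmax R Hs B j u ∨ Frozen η f x₀ s hmax R Hs B j u

/-- `FrozenStepSig` — seam of the TiltedLandingLaw421 descent framework, part 05 (token-identical port of `Cruxes/TiltedLandingLaw421/Lines/law421birthS.lean`; no new mathematics). -/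
def FrozenStepSig (μ : ℝ) (St Ready Frozen : StatePred) : Prop :=
  ∀ (η : ℝ) (f : ℂ → ℂ) (x₀ s hmax R Hs : ℝ) (B : ℕ), EngineHyps5 2 η f x₀ s hmax R Hs B →
    ∀ (j : ℕ) (u : ℂ), St η f x₀ s hmax R Hs B j u → Frozen η f x₀ s hmax R Hs B j u → ¬ Ready η f x₀ s hmax R Hs B j u →
      ∃ u' : ℂ, St η f x₀ s hmax R Hs B (j + 1) u' ∧ |u'.im| + μ * s ≤ |u.im|

/-- `HoldStepSig` — seam of the TiltedLandingLaw421 descent framework, part 05 (token-identical port of `Cruxes/TiltedLandingLaw421/Lines/law421birthS.lean`; no new mathematics). -/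
def HoldStepSig (St Ready : StatePred) : Prop :=
  ∀ (η : ℝ) (f : ℂ → ℂ) (x₀ s hmax R Hs : ℝ) (B : ℕ), EngineHyps5 2 η f x₀ s hmax R Hs B →
    ∀ (j : ℕ) (u : ℂ), St η f x₀ s hmax R Hs B j u → ¬ Ready η f x₀ s hmax R Hs B j u →
      ∃ u' : ℂ, St η f x₀ s hmax R Hs B (j + 1) u' ∧ |u'.im| ≤ |u.im|

/-- `budget_of_quarter_le'` — seam of the TiltedLandingLaw421 descent framework, part 05 (token-identical port of `Cruxes/TiltedLandingLaw421/Lines/law421birthS.lean`; no new mathematics). -/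
theorem budget_of_quarter_le' {μ cE c : ℝ} (hμ : 1 / 4 ≤ μ) (hc : cE ≤ c) {s hmax : ℝ} (hs : 0 < s) (hsh : 2 * s ≤ hmax) :
    hmax / (μ * s) + cE ≤ 4 * hmax / s + c := by
  have hμ0 : 0 < μ := by linarith
  have hμs : 0 < μ * s := mul_pos hμ0 hs
  have hh : 0 ≤ hmax := by linarith
  have key : hmax / (μ * s) ≤ 4 * hmax / s := by
    rw [div_le_iff₀ hμs]
    have : 4 * hmax / s * (μ * s) = 4 * hmax * μ := by
      field_simp
    rw [this]
    nlinarith [mul_nonneg hh (by linarith : (0 : ℝ) ≤ 4 * μ - 1)]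
  linarith

/-- `budget_of_quarter_le` — seam of the TiltedLandingLaw421 descent framework, part 05 (token-identical port of `Cruxes/TiltedLandingLaw421/Lines/law421birthS.lean`; no new mathematics). -/
theorem budget_of_quarter_le {μ c : ℝ} (hμ : 1 / 4 ≤ μ) (hc : 0 ≤ c) {s hmax : ℝ} (hs : 0 < s) (hsh : 2 * s ≤ hmax) :
    hmax / (μ * s) ≤ 4 * hmax / s + c := by
  have hμ0 : 0 < μ := by linarith
  have hμs : 0 < μ * s := mul_pos hμ0 hs
  have hh : 0 ≤ hmax := by linarith
  rw [div_le_iff₀ hμs]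
  have : (4 * hmax / s + c) * (μ * s) = 4 * hmax * μ + c * μ * s := by
    field_simp
  rw [this]
  nlinarith [mul_nonneg hh (by linarith : (0 : ℝ) ≤ 4 * μ - 1), mul_nonneg (mul_nonneg hc hμ0.le) hs.le]

/-- `descentSigC_of_surplus_pieces` — seam of the TiltedLandingLaw421 descent framework, part 05 (token-identical port of `Cruxes/TiltedLandingLaw421/Lines/law421birthS.lean`; no new mathematics). -/
theorem descentSigC_of_surplus_pieces (μ cE c : ℝ) (hμ : 0 < μ) (hc : 0 ≤ c)
    (hbud : ∀ s hmax : ℝ, 0 < s → 2 * s ≤ hmax → hmax / (μ * s) + cE ≤ 4 * hmax / s + c)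
    (St Ready Frozen : StatePred)
    (hI : Init0Sig St) (hSur : SurplusSig cE St Ready Frozen) (hF : FrozenStepSig μ St Ready Frozen)
    (hH : HoldStepSig St Ready) (hL : LandSig St Ready) : DescentSigC c := by
  intro η f x₀ s hmax R Hs B hE
  have hE' := hE
  obtain ⟨-, -, -, hs, hsh, -, -, -, -, -, -, -, -, -, -, -⟩ := hE'
  have hμs : 0 < μ * s := mul_pos hμ hs
  obtain ⟨E, hEcard, hEoff⟩ := hSur η f x₀ s hmax R Hs B hE
  obtain ⟨u₀, hSt0, hu₀⟩ := hI η f x₀ s hmax R Hs B hE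

  let S : ℕ → Finset ℕ := fun j => E.filter (fun e => j ≤ e)
  let Φ : ℕ → ℂ → ℝ := fun j u => |u.im| / (μ * s) + ((S j).card : ℝ)
  have hSmono : ∀ j : ℕ, S (j + 1) ⊆ S j := by
    intro j e he
    simp only [S, Finset.mem_filter] at he ⊢
    exact ⟨he.1, by omega⟩
  have hΦnonneg : ∀ (j : ℕ) (u : ℂ), 0 ≤ Φ j u := by
    intro j u
    have : 0 ≤ |u.im| / (μ * s) := div_nonneg (abs_nonneg _) hμs.le
    have : (0 : ℝ) ≤ (S j).card := Nat.cast_nonneg _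
    simp only [Φ]
    linarith

  have hStep : ∀ (j : ℕ) (u : ℂ), St η f x₀ s hmax R Hs B j u → ¬ Ready η f x₀ s hmax R Hs B j u →
      ∃ u' : ℂ, St η f x₀ s hmax R Hs B (j + 1) u' ∧ 0 ≤ Φ (j + 1) u' ∧ Φ (j + 1) u' + 1 ≤ Φ j u := by
    intro j u hSt hR
    have hcardmono : ((S (j + 1)).card : ℝ) ≤ (S j).card := by
      exact_mod_cast Finset.card_le_card (hSmono j)
    by_cases hjE : j ∈ E
    ·
      obtain ⟨u', hSt', hle⟩ := hH η f x₀ s hmax R Hs B hE j u hSt hR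
      have hjS : j ∈ S j := by
        simp only [S, Finset.mem_filter]
        exact ⟨hjE, le_rfl⟩
      have hjS' : j ∉ S (j + 1) := by
        simp only [S, Finset.mem_filter, not_and, not_le]
        intro _
        omega
      have hss : S (j + 1) ⊂ S j := Finset.ssubset_iff.mpr ⟨j, hjS', Finset.insert_subset hjS (hSmono j)⟩
      have hlt : (S (j + 1)).card < (S j).card := Finset.card_lt_card hss
      have hcard1 : ((S (j + 1)).card : ℝ) + 1 ≤ (S j).card := by
        have : (S (j + 1)).card + 1 ≤ (S j).card := hlt
        exact_mod_cast this
      have hh : |u'.im| / (μ * s) ≤ |u.im| / (μ * s) := div_le_div_of_nonneg_right hle hμs.le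
      refine ⟨u', hSt', hΦnonneg _ _, ?_⟩
      simp only [Φ]
      linarith
    ·
      rcases hEoff j u hjE hSt with hRj | hFz
      · exact absurd hRj hR
      obtain ⟨u', hSt', hdrop⟩ := hF η f x₀ s hmax R Hs B hE j u hSt hFz hR
      have hh : |u'.im| / (μ * s) + 1 ≤ |u.im| / (μ * s) := by
        rw [← sub_nonneg]
        have hne : μ * s ≠ 0 := ne_of_gt hμs
        have : |u.im| / (μ * s) - (|u'.im| / (μ * s) + 1) = (|u.im| - |u'.im| - μ * s) / (μ * s) := by
          field_simp
          ring
        rw [this]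
        exact div_nonneg (by linarith) hμs.le
      refine ⟨u', hSt', hΦnonneg _ _, ?_⟩
      simp only [Φ]
      linarith

  have hS0 : ((S 0).card : ℝ) ≤ (Hs / s) ^ 2 + B + cE := by
    have : (S 0).card ≤ E.card := Finset.card_filter_le _ _
    have : ((S 0).card : ℝ) ≤ E.card := by exact_mod_cast this
    linarith
  have hΦ0 : Φ 0 u₀ ≤ 4 * hmax / s + (Hs / s) ^ 2 + B + c := by
    have h1 : |u₀.im| / (μ * s) ≤ hmax / (μ * s) := div_le_div_of_nonneg_right hu₀ hμs.le
    have h2 := hbud s hmax hs hsh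
    simp only [Φ]
    linarith
  obtain ⟨j, u, hj, hSt, hR⟩ :=
    descent_core (St := St η f x₀ s hmax R Hs B) (Ready := Ready η f x₀ s hmax R Hs B) (Φ := Φ)
      hStep hSt0 hΦ0 (allowance_nonneg hs hsh hc)
  obtain ⟨hnz, α, β, H, hα, hβ, hW⟩ := hL η f x₀ s hmax R Hs B hE j u hSt hR
  exact ⟨j, α, β, H, hj, hα, hβ, hnz, hW⟩

/-- `descentSigS_of_surplus_pieces` — seam of the TiltedLandingLaw421 descent framework, part 05 (token-identical port of `Cruxes/TiltedLandingLaw421/Lines/law421birthS.lean`; no new mathematics). -/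
theorem descentSigS_of_surplus_pieces (μ : ℝ) (hμ : 1 / 4 ≤ μ) (St Ready Frozen : StatePred)
    (hI : Init0Sig St) (hSur : SurplusSig 0 St Ready Frozen) (hF : FrozenStepSig μ St Ready Frozen)
    (hH : HoldStepSig St Ready) (hL : LandSig St Ready) : DescentSigS :=
  descentSigS_of_descentSigC
    (descentSigC_of_surplus_pieces μ 0 0 (by linarith) le_rfl (fun _ _ hs hsh => budget_of_quarter_le' hμ le_rfl hs hsh)
      St Ready Frozen hI hSur hF hH hL)

/-- `descentSigS'_of_surplus_pieces` — seam of the TiltedLandingLaw421 descent framework, part 05 (token-identical port of `Cruxes/TiltedLandingLaw421/Lines/law421birthS.lean`; no new mathematics). -/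
theorem descentSigS'_of_surplus_pieces (μ : ℝ) (hμ : 1 / 4 ≤ μ) (St Ready Frozen : StatePred)
    (hI : Init0Sig St) (hSur : SurplusSig 1 St Ready Frozen) (hF : FrozenStepSig μ St Ready Frozen)
    (hH : HoldStepSig St Ready) (hL : LandSig St Ready) : DescentSigS' :=
  descentSigS'_of_descentSigC
    (descentSigC_of_surplus_pieces μ 1 1 (by linarith) zero_le_one (fun _ _ hs hsh => budget_of_quarter_le' hμ le_rfl hs hsh)
      St Ready Frozen hI hSur hF hH hL)

/-- `surplusSig_mono` — seam of the TiltedLandingLaw421 descent framework, part 05 (token-identical port of `Cruxes/TiltedLandingLaw421/Lines/law421birthS.lean`; no new mathematics). -/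
theorem surplusSig_mono {cE cE' : ℝ} (h : cE ≤ cE') (St Ready Frozen : StatePred) (hS : SurplusSig cE St Ready Frozen) :
    SurplusSig cE' St Ready Frozen := by
  intro η f x₀ s hmax R Hs B hE
  obtain ⟨E, hcard, hoff⟩ := hS η f x₀ s hmax R Hs B hE
  exact ⟨E, by linarith, hoff⟩

/-- `law421T_of_surplus_pieces` — seam of the TiltedLandingLaw421 descent framework, part 05 (token-identical port of `Cruxes/TiltedLandingLaw421/Lines/law421birthS.lean`; no new mathematics). -/
theorem law421T_of_surplus_pieces (μ : ℝ) (hμ : 1 / 4 ≤ μ) (St Ready Frozen : StatePred)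
    (hI : Init0Sig St) (hSur : SurplusSig 0 St Ready Frozen) (hF : FrozenStepSig μ St Ready Frozen)
    (hH : HoldStepSig St Ready) (hL : LandSig St Ready) (hHer : AnalyticHereditySig) :
    RhW07.Seam.Law421Statement :=
  law421T_ofS (descentSigS_of_surplus_pieces μ hμ St Ready Frozen hI hSur hF hH hL) hHer

section Lift
open scoped BigOperators
/-- `SurplusLiftSig` — seam of the TiltedLandingLaw421 descent framework, part 05 (token-identical port of `Cruxes/TiltedLandingLaw421/Lines/law421birthS.lean`; no new mathematics). -/
def SurplusLiftSig (cE : ℝ) (Λ : ℝ → ℝ → ℝ) (St Ready Frozen : StatePred) : Prop :=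
  ∀ (η : ℝ) (f : ℂ → ℂ) (x₀ s hmax R Hs : ℝ) (B : ℕ), EngineHyps5 2 η f x₀ s hmax R Hs B →
    ∃ (E : Finset ℕ) (lam : ℕ → ℝ), (E.card : ℝ) ≤ (Hs / s) ^ 2 + B + cE ∧ (∀ j : ℕ, 0 ≤ lam j) ∧
      (∑ e ∈ E, lam e) ≤ Λ s hmax ∧
      (∀ (j : ℕ) (u : ℂ), j ∉ E → St η f x₀ s hmax R Hs B j u →
        Ready η f x₀ s hmax R Hs B j u ∨ Frozen η f x₀ s hmax R Hs B j u) ∧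
      (∀ (j : ℕ) (u : ℂ), j ∈ E → St η f x₀ s hmax R Hs B j u → ¬ Ready η f x₀ s hmax R Hs B j u →
        ∃ u' : ℂ, St η f x₀ s hmax R Hs B (j + 1) u' ∧ |u'.im| ≤ |u.im| + lam j)


end Lift
end RhIdea6.G19.W07C11.Seam
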